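import Summits.QuantumFields.YangMills.Theorems.FemtoTransferGapBounds

/-!
# Courant–Fischer calculus for the transfer values `levelValue`, and the ABSOLUTE-BOUND seams of crux `OneSiteLevels`
# (support module for the registered stubs `stub_oneSiteEnergyLower` / `stub_oneSiteEnergyUpper` of route `LuscherReduction`,
# item stmt-QuantumFields-20007; fleet lead prover ym-luscher-20007-p1)

The min–max transfer values `levelValue ρ L β k` of `Theorems.FemtoTransferGapLevels` are real `sInf`/`sSup`'s over physical
(bounded, measurable, gauge- and twist-invariant) test functions.  Every semiclassical argument about them (IMS localisation for
energy LOWER bounds, quasimodes for energy UPPER bounds) enters the definition through exactly two doors, typed here once for all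
`L`, `β`, `k` and every continuous representation of a compact group — the transfer-side twin of the tree's
`Literature/Analysis/OperatorTheory/YangMillsMatrixModelMinMax.lean` (which does the same for the levels `physLevel` of Lüscher's `𝔥`):

* §1 `levelValue_le_of_forall_rayleigh_le` — **inf–sup ≤ (the «no intruders» door)**: `k` physical constraint functions `φ_0,…,φ_{k−1}` and a
  uniform bound `⟨ψ,K_βψ⟩ ≤ s‖ψ‖²` on the physical `ψ ⊥ φ_i` give `λ_k ≤ s` (no positivity or boundedness hypothesis: the junk branches of
  `sSup`/`sInf` are `0 ≤ s`); `rayleigh_le_topValue` / `rayleigh_le_levelValue_zero` — a single physical trial function bounds `λ₀` from below.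
* §2 `exists_ne_zero_forall_l2_eq_zero` (rank–nullity) and `le_levelValue_of_subspace` — **the lower-bound principle (the quasimode door)**:
  a `(k+1)`-dimensional space of physical functions with `s‖ψ‖² ≤ ⟨ψ,K_βψ⟩` and `‖ψ‖² > 0` for `ψ ≠ 0` forces `s ≤ λ_k`
  (for every `k` constraints some non-zero element is orthogonal to all of them).
* §3 the two SEAMS of the one-site crux ONE (`OneSiteLevels`, `L = 1`, `SU(2)`): writing `E_k = physLevel (k+1)` and letting `c : ℝ → ℝ` be ANY
  normalising function (intended: `c(B) = (∫_{SU(2)} e^{B Re tr W} dW)³`, the exact top eigenvalue of the pure kinetic factor),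
  ABSOLUTE one-sided bounds `λ_k ≤ c(B)e^{−E_kλ_b + Cλ_b²}` («AbsUpper k») and `c(B)e^{−E_kλ_b − Cλ_b²} ≤ λ_k` («AbsLower k») combine as
  `(∀ k, AbsUpper k) → AbsLower 0 → OneSiteEnergyLower` (`oneSite_energyLower_of_abs`) and
  `(∀ k, AbsLower k) → AbsUpper 0 → OneSiteEnergyUpper` (`oneSite_energyUpper_of_abs`), with the conclusions VERBATIM the statements
  `OneSiteEnergyLower` / `OneSiteEnergyUpper` of the registered BC3 skeleton v4 (8c7f89d0238a73fd) — so each registered stub needs ONE hard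
  absolute upper bound (localisation) and ONE quasimode floor, and the difficulty seam is AbsUpper/AbsLower, not Lower/Upper
  (line card `Lines/energy-lower-abs.md` of this seat).

## WHAT THIS IS NOT
No bound on any transfer value is proved here (AbsUpper/AbsLower are hypotheses of §3); nothing about `β → ∞`; NOT the crux, NOT THE CLAY GAP.
Everything below is sorry-free, no new definition, no named fact.
-/

set_option autoImplicit false

noncomputable section

open MeasureTheory Filter Topology Real
open Literature.MathematicalPhysics.QuantumFieldTheory
open Literature.MathematicalPhysics.QuantumLattice
open Literature.Analysis.OperatorTheory.YMMatrixModel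

namespace Summit.QuantumFields.YangMills.Theorems.FemtoTransferGap

/-! ### §1. inf–sup ≤ : constraints + a uniform Rayleigh bound; a trial function bounds `λ₀` from below -/

section InfSup

variable {N : ℕ} {G : Type*} [Group G] [TopologicalSpace G] [IsTopologicalGroup G] [CompactSpace G]
  [MeasurableSpace G] [BorelSpace G]
variable (ρ : G →* Matrix (Fin N) (Fin N) ℂ)

/-- **inf–sup ≤ («no intruders» door).**  If `φ_0, …, φ_{k−1}` are physical and every physical `ψ` with `⟨ψ, φ_i⟩ = 0` for all `i` and
`‖ψ‖² > 0` satisfies `⟨ψ, K_β ψ⟩ ≤ s ‖ψ‖²`, where `0 ≤ s`, then `λ_k(β, L) ≤ s`.  (Courant–Fischer: `λ_k` is the infimum over `k` constraints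
of the supremum of the constrained Rayleigh quotients; the junk values `sSup ∅ = 0`, `sInf` of an unbounded set `= 0` are covered by `0 ≤ s`.)
[cite: ReedSimonIV1978, Thm. XIII.1] -/
theorem levelValue_le_of_forall_rayleigh_le {L : ℕ} [NeZero L] (β : ℝ) {k : ℕ} {s : ℝ} (hs0 : 0 ≤ s)
    (φs : Fin k → (GaugeConfig 3 L G → ℝ)) (hφ : ∀ i, IsPhys (φs i))
    (hs : ∀ ψ : GaugeConfig 3 L G → ℝ, IsPhys ψ → (∀ i, l2 ψ (φs i) = 0) → 0 < l2 ψ ψ →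
      qform ρ β ψ ψ ≤ s * l2 ψ ψ) :
    levelValue ρ L β k ≤ s := by
  have hsup : sSup (rayleighSet ρ L β fun ψ => ∀ i, l2 ψ (φs i) = 0) ≤ s := by
    by_cases hne : (rayleighSet ρ L β fun ψ => ∀ i, l2 ψ (φs i) = 0).Nonempty
    · refine csSup_le hne ?_
      rintro r ⟨ψ, hψ, hP, hpos, rfl⟩
      rw [div_le_iff₀ hpos]
      exact hs ψ hψ hP hpos
    · rw [Set.not_nonempty_iff_eq_empty.mp hne, Real.sSup_empty]
      exact hs0
  unfold levelValue
  have hmem : sSup (rayleighSet ρ L β fun ψ => ∀ i, l2 ψ (φs i) = 0) ∈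
      {t : ℝ | ∃ φs' : Fin k → (GaugeConfig 3 L G → ℝ), (∀ i, IsPhys (φs' i)) ∧
        t = sSup (rayleighSet ρ L β fun ψ => ∀ i, l2 ψ (φs' i) = 0)} := ⟨φs, hφ, rfl⟩
  by_cases hb : BddBelow {t : ℝ | ∃ φs' : Fin k → (GaugeConfig 3 L G → ℝ), (∀ i, IsPhys (φs' i)) ∧
      t = sSup (rayleighSet ρ L β fun ψ => ∀ i, l2 ψ (φs' i) = 0)}
  · exact (csInf_le hb hmem).trans hsup
  · rw [Real.sInf_of_not_bddBelow hb]
    exact hs0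

/-- The `k = 0` instance: a uniform Rayleigh bound `⟨ψ,K_βψ⟩ ≤ s‖ψ‖²` (`0 ≤ s`) on physical test functions gives `λ₀ ≤ s` in
`levelValue` form. [cite: ReedSimonIV1978, Thm. XIII.1] -/
theorem levelValue_zero_le_of_forall_rayleigh_le {L : ℕ} [NeZero L] (β : ℝ) {s : ℝ} (hs0 : 0 ≤ s)
    (hs : ∀ ψ : GaugeConfig 3 L G → ℝ, IsPhys ψ → 0 < l2 ψ ψ → qform ρ β ψ ψ ≤ s * l2 ψ ψ) :
    levelValue ρ L β 0 ≤ s :=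
  levelValue_le_of_forall_rayleigh_le ρ β hs0 (fun i => Fin.elim0 i) (fun i => Fin.elim0 i)
    fun ψ hψ _ hpos => hs ψ hψ hpos

/-- **A trial function bounds `λ₀` from below**: `⟨ψ,K_βψ⟩/‖ψ‖² ≤ λ₀` for every physical `ψ` with `‖ψ‖² > 0` (the Rayleigh set is bounded
above for a continuous representation of a compact group, `bddAbove_rayleighSet`). [cite: ReedSimonIV1978, Thm. XIII.1] -/
theorem rayleigh_le_topValue {L : ℕ} [NeZero L] (hρ : Continuous ρ) (β : ℝ) {ψ : GaugeConfig 3 L G → ℝ}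
    (hψ : IsPhys ψ) (hpos : 0 < l2 ψ ψ) : qform ρ β ψ ψ / l2 ψ ψ ≤ topValue ρ L β := by
  unfold topValue
  exact le_csSup (bddAbove_rayleighSet ρ hρ β _) ⟨ψ, hψ, trivial, hpos, rfl⟩

/-- The same in `levelValue` form: `⟨ψ,K_βψ⟩/‖ψ‖² ≤ λ_0`. [cite: ReedSimonIV1978, Thm. XIII.1] -/
theorem rayleigh_le_levelValue_zero {L : ℕ} [NeZero L] (hρ : Continuous ρ) (β : ℝ) {ψ : GaugeConfig 3 L G → ℝ}
    (hψ : IsPhys ψ) (hpos : 0 < l2 ψ ψ) : qform ρ β ψ ψ / l2 ψ ψ ≤ levelValue ρ L β 0 := by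
  rw [levelValue_zero]
  exact rayleigh_le_topValue ρ hρ β hψ hpos

/-- Product form of the trial-function bound: `⟨ψ,K_βψ⟩ ≤ λ_0 ‖ψ‖²` (no division). [cite: ReedSimonIV1978, Thm. XIII.1] -/
theorem qform_le_levelValue_zero_mul {L : ℕ} [NeZero L] (hρ : Continuous ρ) (β : ℝ) {ψ : GaugeConfig 3 L G → ℝ}
    (hψ : IsPhys ψ) (hpos : 0 < l2 ψ ψ) : qform ρ β ψ ψ ≤ levelValue ρ L β 0 * l2 ψ ψ := by
  have h := rayleigh_le_levelValue_zero ρ hρ β hψ hpos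
  rwa [div_le_iff₀ hpos] at h

end InfSup

/-! ### §2. The lower-bound principle: a `(k+1)`-dimensional physical trial space bounds `λ_k` from below -/

section SupInf

variable {N : ℕ} {G : Type*} [Group G] [TopologicalSpace G] [IsTopologicalGroup G] [CompactSpace G]
  [MeasurableSpace G] [BorelSpace G]
variable (ρ : G →* Matrix (Fin N) (Fin N) ℂ)

/-- The product of two physical test functions is integrable (both are bounded and measurable; the configuration measure is finite). [folklore] -/
theorem IsPhys.integrable_mul {L : ℕ} [NeZero L] {ψ φ : GaugeConfig 3 L G → ℝ} (hψ : IsPhys ψ) (hφ : IsPhys φ) :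
    Integrable (fun U => ψ U * φ U) (configMeasure G L) := by
  obtain ⟨C, hC⟩ := hψ.bounded
  obtain ⟨D, hD⟩ := hφ.bounded
  refine Integrable.mono' (integrable_const (C * D)) (hψ.measurable.mul hφ.measurable).aestronglyMeasurable
    (ae_of_all _ fun U => ?_)
  rw [Real.norm_eq_abs, abs_mul]
  exact mul_le_mul (hC U) (hD U) (abs_nonneg _) ((abs_nonneg _).trans (hC U))

/-- `l2` is additive in its first argument on physical test functions. [folklore] -/
theorem l2_add_left {L : ℕ} [NeZero L] {ψ ψ' φ : GaugeConfig 3 L G → ℝ} (hψ : IsPhys ψ) (hψ' : IsPhys ψ') (hφ : IsPhys φ) :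
    l2 (ψ + ψ') φ = l2 ψ φ + l2 ψ' φ := by
  unfold l2
  simp only [Pi.add_apply, add_mul]
  exact integral_add (hψ.integrable_mul hφ) (hψ'.integrable_mul hφ)

/-- `l2` is homogeneous in its first argument. [folklore] -/
theorem l2_smul_left {L : ℕ} [NeZero L] (a : ℝ) (ψ φ : GaugeConfig 3 L G → ℝ) :
    l2 (a • ψ) φ = a * l2 ψ φ := by
  unfold l2
  simp only [Pi.smul_apply, smul_eq_mul, mul_assoc]
  exact integral_const_mul _ _

/-- **Rank–nullity supply of constrained trial functions**: a `k`-dimensional space `W` of physical test functions contains a NON-ZERO function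
`L²`-orthogonal to any `n < k` physical functions `φ_1, …, φ_n` (the moment map `W → ℝⁿ` has a non-trivial kernel).
[cite: ReedSimonIV1978, Thm. XIII.1] -/
theorem exists_ne_zero_forall_l2_eq_zero {L : ℕ} [NeZero L] {k n : ℕ} (hn : n < k)
    (W : Submodule ℝ (GaugeConfig 3 L G → ℝ)) (hW : Module.finrank ℝ W = k) (hadm : ∀ ψ ∈ W, IsPhys ψ)
    (φs : Fin n → GaugeConfig 3 L G → ℝ) (hφ : ∀ i, IsPhys (φs i)) :
    ∃ ψ ∈ W, ψ ≠ 0 ∧ ∀ i, l2 ψ (φs i) = 0 := by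
  obtain ⟨m, rfl⟩ : ∃ m, k = m + 1 := ⟨k - 1, by omega⟩
  haveI : Module.Finite ℝ W := Module.finite_of_finrank_eq_succ hW
  let Φ : W →ₗ[ℝ] (Fin n → ℝ) :=
    { toFun := fun ψ i => l2 (ψ : GaugeConfig 3 L G → ℝ) (φs i)
      map_add' := fun ψ ψ' => by
        funext i
        simp only [Submodule.coe_add, Pi.add_apply]
        exact l2_add_left (hadm _ ψ.2) (hadm _ ψ'.2) (hφ i)
      map_smul' := fun a ψ => by
        funext i
        simp only [Submodule.coe_smul, Pi.smul_apply, smul_eq_mul, RingHom.id_apply]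
        exact l2_smul_left a _ _ }
  have hrank : Module.finrank ℝ (LinearMap.range Φ) ≤ n :=
    (Submodule.finrank_le _).trans (by simp)
  have hker : 0 < Module.finrank ℝ (LinearMap.ker Φ) := by
    have h := LinearMap.finrank_range_add_finrank_ker Φ
    rw [hW] at h
    omega
  obtain ⟨⟨ψ, hψker⟩, hne⟩ := (Module.finrank_pos_iff_exists_ne_zero (R := ℝ) (M := LinearMap.ker Φ)).1 hker
  refine ⟨(ψ : GaugeConfig 3 L G → ℝ), ψ.2, fun h0 => hne ?_, fun i => ?_⟩
  · have hψ0 : ψ = 0 := Subtype.ext h0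
    exact Subtype.ext hψ0
  · have h := LinearMap.mem_ker.1 hψker
    exact congr_fun h i

/-- **The lower-bound principle (the quasimode door)**: if a `(k+1)`-dimensional space `W` of physical test functions has `‖ψ‖² > 0` for its
non-zero elements and `s ‖ψ‖² ≤ ⟨ψ, K_β ψ⟩` throughout, then `s ≤ λ_k(β, L)` — for every choice of `k` physical constraint functions some
non-zero `ψ ∈ W` is orthogonal to all of them, and its Rayleigh quotient `≥ s` lies in the constrained Rayleigh set (bounded above:
`bddAbove_rayleighSet`). [cite: ReedSimonIV1978, Thm. XIII.1] -/
theorem le_levelValue_of_subspace {L : ℕ} [NeZero L] (hρ : Continuous ρ) (β : ℝ) {k : ℕ} {s : ℝ}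
    (W : Submodule ℝ (GaugeConfig 3 L G → ℝ)) (hW : Module.finrank ℝ W = k + 1) (hadm : ∀ ψ ∈ W, IsPhys ψ)
    (hl2 : ∀ ψ ∈ W, ψ ≠ 0 → 0 < l2 ψ ψ) (hs : ∀ ψ ∈ W, s * l2 ψ ψ ≤ qform ρ β ψ ψ) :
    s ≤ levelValue ρ L β k := by
  unfold levelValue
  refine le_csInf ⟨_, fun _ _ => 1, fun _ => isPhys_const 1, rfl⟩ ?_
  rintro t ⟨φs, hφ, rfl⟩
  obtain ⟨ψ, hψW, hne, horth⟩ := exists_ne_zero_forall_l2_eq_zero (lt_add_one k) W hW hadm φs hφ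
  have hpos : 0 < l2 ψ ψ := hl2 ψ hψW hne
  have hmem : qform ρ β ψ ψ / l2 ψ ψ ∈ rayleighSet ρ L β (fun ψ => ∀ i, l2 ψ (φs i) = 0) :=
    ⟨ψ, hadm ψ hψW, horth, hpos, rfl⟩
  have h1 : s ≤ qform ρ β ψ ψ / l2 ψ ψ := by
    rw [le_div_iff₀ hpos]
    exact hs ψ hψW
  exact h1.trans (le_csSup (bddAbove_rayleighSet ρ hρ β _) hmem)

end SupInf

/-! ### §3. The seams of crux ONE: absolute one-sided bounds against a common normalisation ⟹ the registered stub statements -/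

section Seams

/-- **SEAM for `stub_oneSiteEnergyLower`.**  For ANY normalising function `c` (intended: the cube of the one-link factor
`∫_{SU(2)} e^{B Re tr W} dW`): if every level obeys the absolute UPPER bound `λ_k ≤ c(B) e^{−E_kλ_b + Cλ_b²}` eventually («AbsUpper k»,
`E_k = physLevel (k+1)`; the hard half: IMS localisation, no intruder states) and the top value obeys the absolute quasimode FLOOR
`c(B) e^{−E_0λ_b − Cλ_b²} ≤ λ_0` eventually («AbsLower 0»), then — VERBATIM the statement `OneSiteEnergyLower` of the registered BC3 skeleton of
`OneSiteLevels` — `λ_k ≤ e^{−(Δ_kλ_b − Cλ_b²)} λ_0` eventually, `Δ_k = levelGap k = E_k − E_0`, with `C := C₁ + C₂`.  Pure bookkeeping with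
`exp`; no sign condition on `c`. [cite: Luscher1983, §1] -/
theorem oneSite_energyLower_of_abs (c : ℝ → ℝ)
    (hup : ∀ k : ℕ, ∃ C B0 : ℝ, ∀ B : ℝ, B0 ≤ B →
      levelValue su2Rep 1 B k ≤ c B * Real.exp (-(physLevel (k + 1) * bareLambda B) + C * bareLambda B ^ 2))
    (hlow : ∃ C B0 : ℝ, ∀ B : ℝ, B0 ≤ B →
      c B * Real.exp (-(physLevel 1 * bareLambda B) - C * bareLambda B ^ 2) ≤ levelValue su2Rep 1 B 0) :
    ∀ k : ℕ, ∃ C B0 : ℝ, ∀ B : ℝ, B0 ≤ B →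
      levelValue su2Rep 1 B k ≤
        Real.exp (-(levelGap k * bareLambda B - C * bareLambda B ^ 2)) * levelValue su2Rep 1 B 0 := by
  intro k
  obtain ⟨C₁, B₁, h₁⟩ := hup k
  obtain ⟨C₂, B₂, h₂⟩ := hlow
  refine ⟨C₁ + C₂, max B₁ B₂, fun B hB => ?_⟩
  have hB₁ : B₁ ≤ B := (le_max_left _ _).trans hB
  have hB₂ : B₂ ≤ B := (le_max_right _ _).trans hB
  set x := bareLambda B with hx
  set a : ℝ := physLevel 1 * x + C₂ * x ^ 2 with ha
  set y : ℝ := -(physLevel (k + 1) * x) + C₁ * x ^ 2 with hy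
  -- `c(B) ≤ λ_0 · e^{a}` from the floor
  have hc : c B ≤ levelValue su2Rep 1 B 0 * Real.exp a := by
    have h := mul_le_mul_of_nonneg_right (h₂ B hB₂) (Real.exp_pos a).le
    have e : c B * Real.exp (-(physLevel 1 * x) - C₂ * x ^ 2) * Real.exp a = c B := by
      rw [mul_assoc, ← Real.exp_add]
      have : -(physLevel 1 * x) - C₂ * x ^ 2 + a = 0 := by rw [ha]; ring
      rw [this, Real.exp_zero, mul_one]
    rwa [e] at h
  have hk : levelValue su2Rep 1 B k ≤ c B * Real.exp y := h₁ B hB₁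
  have h3 : c B * Real.exp y ≤ levelValue su2Rep 1 B 0 * Real.exp a * Real.exp y :=
    mul_le_mul_of_nonneg_right hc (Real.exp_pos y).le
  have e2 : levelValue su2Rep 1 B 0 * Real.exp a * Real.exp y =
      Real.exp (-(levelGap k * x - (C₁ + C₂) * x ^ 2)) * levelValue su2Rep 1 B 0 := by
    rw [mul_assoc, ← Real.exp_add, mul_comm]
    congr 1
    rw [ha, hy, levelGap]
    ring_nf
  calc levelValue su2Rep 1 B k ≤ c B * Real.exp y := hk
    _ ≤ levelValue su2Rep 1 B 0 * Real.exp a * Real.exp y := h3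
    _ = Real.exp (-(levelGap k * x - (C₁ + C₂) * x ^ 2)) * levelValue su2Rep 1 B 0 := e2

/-- **SEAM for `stub_oneSiteEnergyUpper`.**  For ANY normalising function `c`: if every level obeys the absolute quasimode FLOOR
`c(B) e^{−E_kλ_b − Cλ_b²} ≤ λ_k` eventually («AbsLower k») and the top value obeys the absolute UPPER bound `λ_0 ≤ c(B) e^{−E_0λ_b + Cλ_b²}`
eventually («AbsUpper 0», the hard half at `k = 0`), then — VERBATIM the statement `OneSiteEnergyUpper` of the registered BC3 skeleton of
`OneSiteLevels` — `e^{−(Δ_kλ_b + Cλ_b²)} λ_0 ≤ λ_k` eventually, `C := C₁ + C₂`. [cite: Luscher1983, §1] -/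
theorem oneSite_energyUpper_of_abs (c : ℝ → ℝ)
    (hlow : ∀ k : ℕ, ∃ C B0 : ℝ, ∀ B : ℝ, B0 ≤ B →
      c B * Real.exp (-(physLevel (k + 1) * bareLambda B) - C * bareLambda B ^ 2) ≤ levelValue su2Rep 1 B k)
    (hup : ∃ C B0 : ℝ, ∀ B : ℝ, B0 ≤ B →
      levelValue su2Rep 1 B 0 ≤ c B * Real.exp (-(physLevel 1 * bareLambda B) + C * bareLambda B ^ 2)) :
    ∀ k : ℕ, ∃ C B0 : ℝ, ∀ B : ℝ, B0 ≤ B →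
      Real.exp (-(levelGap k * bareLambda B + C * bareLambda B ^ 2)) * levelValue su2Rep 1 B 0 ≤
        levelValue su2Rep 1 B k := by
  intro k
  obtain ⟨C₁, B₁, h₁⟩ := hlow k
  obtain ⟨C₂, B₂, h₂⟩ := hup
  refine ⟨C₁ + C₂, max B₁ B₂, fun B hB => ?_⟩
  have hB₁ : B₁ ≤ B := (le_max_left _ _).trans hB
  have hB₂ : B₂ ≤ B := (le_max_right _ _).trans hB
  set x := bareLambda B with hx
  set a : ℝ := -(physLevel 1 * x) + C₂ * x ^ 2 with ha
  set y : ℝ := -(physLevel (k + 1) * x) - C₁ * x ^ 2 with hy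
  -- `λ_0 · e^{−a} ≤ c(B)` from the top-value upper bound
  have hc : levelValue su2Rep 1 B 0 * Real.exp (-a) ≤ c B := by
    have h := mul_le_mul_of_nonneg_right (h₂ B hB₂) (Real.exp_pos (-a)).le
    have e : c B * Real.exp a * Real.exp (-a) = c B := by
      rw [mul_assoc, ← Real.exp_add, add_neg_cancel, Real.exp_zero, mul_one]
    rwa [e] at h
  have hk : c B * Real.exp y ≤ levelValue su2Rep 1 B k := h₁ B hB₁
  have h3 : levelValue su2Rep 1 B 0 * Real.exp (-a) * Real.exp y ≤ c B * Real.exp y :=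
    mul_le_mul_of_nonneg_right hc (Real.exp_pos y).le
  have e2 : levelValue su2Rep 1 B 0 * Real.exp (-a) * Real.exp y =
      Real.exp (-(levelGap k * x + (C₁ + C₂) * x ^ 2)) * levelValue su2Rep 1 B 0 := by
    rw [mul_assoc, ← Real.exp_add, mul_comm]
    congr 1
    rw [ha, hy, levelGap]
    ring_nf
  calc Real.exp (-(levelGap k * x + (C₁ + C₂) * x ^ 2)) * levelValue su2Rep 1 B 0
      = levelValue su2Rep 1 B 0 * Real.exp (-a) * Real.exp y := e2.symm
    _ ≤ c B * Real.exp y := h3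
    _ ≤ levelValue su2Rep 1 B k := hk

end Seams

end Summit.QuantumFields.YangMills.Theorems.FemtoTransferGap

end
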